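import Summits.BirchSwinnertonDyer.Rank1Residual.GaloisImage.NonsplitMultiplicativeKummerTransport
import HarnessLib

/-!
# The refined visibility certificate with FIVE free kinds of place (cell `b2b-bsdres`, team n1011,
# rows T-NSK / T-NSK2; seat p04 GEN 10; FILE B of T-NSK2)

HONEST FRAMING (cell `b2b-bsdres`, run/shared/lean/b2b/bsd-rank1-residual/, verbatim in every
file): the goal of the cell is to DELETE the COMBINATION-SHAPED residual classes of the
Birch–Swinnerton-Dyer formula for ALL analytic-rank `≤ 1` elliptic curves over `ℚ` — "full BSD
formula for every rank `≤ 1` curve in class `C`" assembled STRICTLY from published theorems — so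
that the rank-`≤ 1` remainder becomes exactly the CONSTRUCTION-SHAPED classes, which are TYPED
(missing-input `Prop`s), NOT attempted. This is not "finishing BSD". Team n1011 (N10 / N11, the
additive block X4 ∧ `p = 3`): research route on the CONSTRUCTION-SHAPED class X4; no claim beyond
the stated classes; nothing is booked; no mark / label / count is changed by this file. Theorems
only (no definition, no new named fact, no `sorry`); general (any number field, any odd prime `p`)
and cell-independent. CONDITIONAL on the registered named fact
`Silverman1994_thmV53_corV54_tateUniformisation` (`hU2`, the cell's A41). Closes NO class by
itself: it frees one more kind of place in a per-row visibility certificate whose other inputs are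
EVIDENCE until kernel-certified.

## What

`NonsplitKummer.exists_sha_ne_zero_of_congr_of_places₅`: the tree's refined certificate
`exists_sha_ne_zero_of_congr_of_places` (x11a; kinds (i) `v ∤ p ∧ E′(K_v)[p] = 0`, (ii) both split
multiplicative ∧ `#E(K_v)[p] ≤ p`, (iii) both multiplicative of the same twist class ∧
`μ_p(K_v) = 1`) extended by the two non-split kinds of this seat: (iv′) `E` multiplicative with
`γ(E) = -c₄/c₆` a non-square in `K_v`, `E′` good, `v ∤ p`
(`h1Equiv_mem_selmerLocalKer_of_nonsplit_of_hasGoodReductionAt`, T-NSK) and (vi) `E` good, `E′`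
multiplicative with `γ(E′)` a non-square in `K_v`, `v ∤ p`
(`h1Equiv_mem_selmerLocalKer_of_hasGoodReductionAt_of_nonsplit`, T-NSK2). `p` an odd prime, any
number field `K`; conditional on the Tate-uniformisation facts `hU` (A40), `hU2` (A41).

References: [CremonaMazur2000] §3; [AgasheStein2002] Thm. 3.1; [MilneADT2006] I Prop. 3.8;
[SilvermanATAEC1994] Ch. V.
-/

noncomputable section

open scoped Classical
open Field NumberField IsDedekindDomain WeierstrassCurve
open Literature.NumberTheory.EllipticCurves Literature.NumberTheory.GaloisRepresentations

namespace Summit.BirchSwinnertonDyer.Rank1Residual.GaloisImage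

namespace NonsplitKummer

variable {K : Type} [Field K] [NumberField K] (W : WeierstrassCurve K) [W.IsElliptic]

/-- **The refined visibility certificate with FIVE free kinds**: `p` an odd prime,
`θ : E′[p] ⥲ E[p]` a `Γ_K`-isomorphism, `S ⊇ T` finite sets of finite places with both curves good
and `v ∤ p` outside `S`, `E(K)` finite of order prime to `p`, (a)
`∏_{v ∈ T} #E′(K_v)[p] · #(𝓞_v/p) < p^{rank E′(K)}`, and (b) every `v ∈ S \ T` of one of the free
kinds (i) `v ∤ p`, `E′(K_v)[p] = 0`; (ii) both split multiplicative, `#E(K_v)[p] ≤ p`; (iii) both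
multiplicative, `γ(E) = r² γ(E′)` in `K_v`, `μ_p(K_v) = 1`; (iv′) `E` multiplicative with `γ(E)` a
non-square in `K_v`, `E′` good, `v ∤ p`; **(vi) `E` good, `E′` multiplicative with `γ(E′)` a
non-square in `K_v`, `v ∤ p`**. Then `Ш(E/K)` has a non-zero element killed by `p`.
[cite: CremonaMazur2000, §3 and Table 1] [cite: AgasheStein2002, Thm. 3.1 and §3.5]
[cite: SilvermanATAEC1994, Ch. V Thm. 3.1, Lemma 5.2, Thm. 5.3, Cor. 5.4]
[cite: MilneADT2006, Ch. I Prop. 3.8] -/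
theorem exists_sha_ne_zero_of_congr_of_places₅
    (hU : Silverman1994_thmV53_tateUniformisation.{0})
    (hU2 : Silverman1994_thmV53_corV54_tateUniformisation.{0}) {p : ℕ} [hpr : Fact p.Prime]
    (hp2 : p ≠ 2) (W' : WeierstrassCurve K) [W'.IsElliptic]
    (θ : geomTorsion W' (p : ℤ) ≃+ geomTorsion W (p : ℤ))
    (hθ : ∀ (σ : absoluteGaloisGroup K) (P : geomTorsion W' (p : ℤ)), θ (σ • P) = σ • θ P)
    (S T : Finset (HeightOneSpectrum (𝓞 K))) (hTS : T ⊆ S)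
    (hS : ∀ w : HeightOneSpectrum (𝓞 K), w ∉ S →
      W.HasGoodReductionAt w ∧ W'.HasGoodReductionAt w ∧ (p : 𝓞 K) ∉ w.asIdeal)
    (hfin : Finite W.toAffine.Point) (hcop : (Nat.card W.toAffine.Point).Coprime p)
    (hT : (∏ w ∈ T, Nat.card (nsmulAddMonoidHom p :
        (W'.baseChange (w.adicCompletion K)).toAffine.Point →+ _).ker *
        Nat.card (w.adicCompletionIntegers K ⧸
          Ideal.span {(p : w.adicCompletionIntegers K)})) < p ^ W'.mordellWeilRank)
    (hplaces : ∀ w ∈ S, w ∉ T →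
      ((p : 𝓞 K) ∉ w.asIdeal ∧ Nat.card (nsmulAddMonoidHom p :
          (W'.baseChange (w.adicCompletion K)).toAffine.Point →+ _).ker = 1) ∨
      (W.HasSplitMultiplicativeReductionAt w ∧ W'.HasSplitMultiplicativeReductionAt w ∧
        Nat.card (nsmulAddMonoidHom p :
          (W.baseChange (w.adicCompletion K)).toAffine.Point →+ _).ker ≤ p) ∨
      (W.HasMultiplicativeReductionAt w ∧ W'.HasMultiplicativeReductionAt w ∧
        (∃ r : w.adicCompletion K, algebraMap K (w.adicCompletion K) (-(W.c₄ / W.c₆)) =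
          r ^ 2 * algebraMap K (w.adicCompletion K) (-(W'.c₄ / W'.c₆))) ∧
        (∀ ζ : w.adicCompletion K, ζ ^ p = 1 → ζ = 1)) ∨
      (W.HasMultiplicativeReductionAt w ∧
        ¬ IsSquare (algebraMap K (w.adicCompletion K) (-(W.c₄ / W.c₆))) ∧
        W'.HasGoodReductionAt w ∧ (p : 𝓞 K) ∉ w.asIdeal) ∨
      (W.HasGoodReductionAt w ∧ W'.HasMultiplicativeReductionAt w ∧
        ¬ IsSquare (algebraMap K (w.adicCompletion K) (-(W'.c₄ / W'.c₆))) ∧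
        (p : 𝓞 K) ∉ w.asIdeal)) :
    ∃ c : W.sha, c ≠ 0 ∧ p • c = 0 := by
  have hpp : p.Prime := hpr.out
  haveI := hfin
  refine exists_sha_ne_zero_of_congr_of_le_off W W' hp2 θ hθ S T hTS hS (fun w hw hwT c hc ↦ ?_) ?_
  · rcases hplaces w hw hwT with ⟨hwp, hloc⟩ | ⟨hWw, hW'w, hcardw⟩ | ⟨hWw, hW'w, hγw, hμw⟩ |
        ⟨hWw, hγw, hW'w, hwp⟩ | ⟨hWw, hW'w, hγw, hwp⟩
    · exact (relIndex_map_selmerLocalKer_eq_one_iff W W' θ hθ).mp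
        (relIndex_map_selmerLocalKer_eq_one_of_card_torsion_eq_one W W' θ hθ hwp hloc) c hc
    · exact W.h1Equiv_mem_selmerLocalKer_of_hasSplitMultiplicativeReductionAt w hU W' θ hθ hWw
        hW'w hcardw hc
    · exact W.h1Equiv_mem_selmerLocalKer_of_hasMultiplicativeReductionAt w hU2 hp2 W' θ hθ hWw
        hW'w hγw hμw hc
    · exact h1Equiv_mem_selmerLocalKer_of_nonsplit_of_hasGoodReductionAt W w hU2 hp2 W' θ hθ hWw
        hγw hW'w hwp hc
    · exact h1Equiv_mem_selmerLocalKer_of_hasGoodReductionAt_of_nonsplit W W' w hU2 hp2 θ hθ hWw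
        hW'w hγw hwp hc
  · rw [index_range_zsmul_eq_one_of_coprime hcop, one_mul,
      Finset.prod_congr rfl fun w _ ↦
        (W'.natCard_kummerLocalConditionAt_adicCompletion w hpp.ne_zero)]
    exact lt_of_lt_of_le hT (pow_mordellWeilRank_le_index_range_zsmul W' hpp.ne_zero)

end NonsplitKummer

end Summit.BirchSwinnertonDyer.Rank1Residual.GaloisImage

end
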